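import Literature.NumberTheory.Sieve.MontgomeryVaughan1975Section7
import HarnessLib

/-!
# Montgomery–Vaughan (1975), Lemma 4.3: monotonicity in the constant of Lemma 4.1, and the
assembly of (8.3) and Theorem 1 from the unparametrised fact `lemma43_gallagher` — PROVED

H. L. Montgomery, R. C. Vaughan, *The exceptional set in Goldbach's problem*, Acta Arith. 27
(1975) 353–370 [MontgomeryVaughanActa1975], §4 (pp. 356–358) and §§7–8.

The tree vendors LEMMA 4.3 (= Gallagher, Invent. Math. 11 (1970), Theorem 7, "with two
modifications") as the named fact `lemma43_gallagher ↔ ∃ c₁ > 0, lemma43At c₁`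
(`MontgomeryVaughan1975MajorArcs.lean`, `MontgomeryVaughan1975Section7.lean`), where `c₁` is the
constant of LEMMA 4.1 delineating the exceptional character at level `P`
(`IsExceptionalZero c₁ P r χ β`: `1 − c₁/log P ≤ β < 1`). Downstream, §7 (`section7_errorBounds_of_lemma43At_small`)
needs `lemma43At c₁` for `c₁` BELOW the absolute constant of Page's theorem (`lemma41At_of_lt`),
whereas the fact only provides SOME `c₁ > 0`. This file closes that gap:

* `lemma43At_anti` — **`lemma43At` is antitone in `c₁`**: if (4.2) holds with the exceptional
  character delineated by `c₁`, it holds (with new absolute constants) with any `0 < c₁' ≤ c₁`.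
  The only new case is a zero `β̃` of `χ̃` exceptional for `c₁` but not for `c₁'`
  (`1 − c₁/log P ≤ β̃ < 1 − c₁'/log P`): then (4.2) at level `c₁` bounds the sum with the term of
  `χ̃` CORRECTED by `+∑_{x−h<n≤x} n^{β̃−1}` and with the factor `(1 − β̃) log P ≤ c₁`, and the
  correction of that single term is small because `β̃` is not too close to `1`:
  `(h + N/P)⁻¹ ∑_{x−h<n≤x} n^{β̃−1} ≤ P⁻¹ + e^{2c₁'} exp(−c₁' log N/log P)`
  (`inv_mul_sum_rpow_le`: the `n ≤ N/P²` contribute at most `N/P²` terms `≤ 1` against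
  `(N/P)⁻¹`; the others are `≤ (N/P²)^{β̃−1} ≤ (N/P²)^{−c₁'/log P}` each, at most `h` of them
  against `h⁻¹`), while `P⁻¹ ≤ exp(−log N/log P)` in the range `P ≥ exp(log^{1/2} N)` of Lemma 4.3.
* `section6_formulae_anti` — the §6 formulae are likewise antitone in `c₁` (trivially: a
  `c₁'`-exceptional datum is `c₁`-exceptional).
* Hence the assembly from the two UNPARAMETRISED inputs:
  `section7_errorBounds_of_lemma43_gallagher : lemma43_gallagher → ∃ c > 0, ∀ 0 < c₁ < c, section7_errorBounds c₁`,
  `majorArc_formulae_of_lemma43_gallagher`, `majorArc_lowerBound_of_lemma43_gallagher :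
  lemma43_gallagher → (∃ c₁ > 0, section6_formulae c₁) → majorArc_lowerBound` ((8.3)), and
  `Literature.NumberTheory.Sieve.goldbachExceptionalCount_isBigO_rpow_of_lemma43_gallagher` (Theorem 1, parity.S15).

After this file the named facts `majorArc_lowerBound` ((8.3)) and
`Literature.NumberTheory.Sieve.goldbachExceptionalCount_isBigO_rpow` (Theorem 1) rest on exactly
`lemma43_gallagher` (Gallagher's Theorem 7 as modified by M–V — log-free zero-density estimates and
the Deuring–Heilbronn phenomenon, the deep input) and `∃ c₁ > 0, section6_formulae c₁` (whose first
conjunct (6.17) is PROVED, `majorArc_formula_nonexceptional`; the second, (6.1͂7), is the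
exceptional-character variant).

## What a proof of `lemma43_gallagher` needs (survey of the tree, 2026-08-15)

(a) the truncated explicit formula for `ψ₀(x, χ)` — the named facts
`Literature.NumberTheory.LFunctions.truncatedExplicitFormula_psiChar` (MV I, Thm 12.10) and
`Literature.NumberTheory.LFunctions.truncatedExplicitFormula_psi` (Thm 12.5); (b) the Landau–Page
lemma in the box `|t| ≤ T = P⁶`, `q ≤ P`, with simplicity of the exceptional zero — ingredients
PROVED (`Literature.NumberTheory.LFunctions.DirichletZFR.exists_zeroFree` = MV I Thm 11.3,
`exists_exceptionalZero_unique`, `Literature/NumberTheory/LFunctions/ExceptionalZeroSimple.lean`);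
(c) the log-free zero-density estimate `∑_{q≤T} ∑*_χ N(α, T, χ) ≪ T^{c(1−α)}` (Gallagher 1970
Thm 6; Bombieri, *Le grand crible*, Thm 14) with (d) the Deuring–Heilbronn factor `δ₁ log T` —
ABSENT from the tree; (e) the derivation of Theorem 7 from (a)–(d) (Gallagher §5; M–V p. 357–358).

## References

* H. L. Montgomery, R. C. Vaughan, Acta Arith. 27 (1975) 353–370, Lemma 4.3 (4.2), §7, §8
  [MontgomeryVaughanActa1975].
* P. X. Gallagher, *A large sieve density estimate near σ = 1*, Invent. Math. 11 (1970) 329–339,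
  Theorems 6–7 [Gallagher1970].
-/

noncomputable section

open Finset Real

namespace Literature.NumberTheory.Sieve.MontgomeryVaughan1975

/-! ### Exceptional data and the constant `c₁` -/

/-- A datum exceptional at level `c₁'` is exceptional at every level `c₁ ≥ c₁'` (for `P ≥ 1`):
`1 − c₁/log P ≤ 1 − c₁'/log P ≤ β`. [cite: MontgomeryVaughanActa1975, §4 Lemma 4.1] -/
theorem IsExceptionalZero.mono {c₁ c₁' P : ℝ} (hle : c₁' ≤ c₁) (hP : 1 ≤ P) {r : ℕ} [NeZero r]
    {χ : DirichletCharacter ℂ r} {β : ℝ} (h : IsExceptionalZero c₁' P r χ β) :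
    IsExceptionalZero c₁ P r χ β := by
  obtain ⟨hprim, hne, hrP, hβ, hβ1, hzero⟩ := h
  refine ⟨hprim, hne, hrP, ?_, hβ1, hzero⟩
  have hlog : 0 ≤ Real.log P := Real.log_nonneg hP
  have : c₁' / Real.log P ≤ c₁ / Real.log P := div_le_div_of_nonneg_right hle hlog
  linarith

/-- If `β` is exceptional at level `c₁` but not at level `c₁'`, then `β < 1 − c₁'/log P`.
[cite: MontgomeryVaughanActa1975, §4 Lemma 4.1] -/
theorem IsExceptionalZero.lt_of_not {c₁ c₁' P : ℝ} {r : ℕ} [NeZero r]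
    {χ : DirichletCharacter ℂ r} {β : ℝ} (h : IsExceptionalZero c₁ P r χ β)
    (h' : ¬ IsExceptionalZero c₁' P r χ β) : β < 1 - c₁' / Real.log P := by
  obtain ⟨hprim, hne, hrP, _, hβ1, hzero⟩ := h
  by_contra hcon
  exact h' ⟨hprim, hne, hrP, not_lt.mp hcon, hβ1, hzero⟩

/-- For an exceptional datum, `0 ≤ (1 − β) log P ≤ c₁` when `P ≥ 1`.
[cite: MontgomeryVaughanActa1975, §4 Lemma 4.1 (4.1)] -/
theorem IsExceptionalZero.one_sub_mul_log_le {c₁ P : ℝ} (hc₁ : 0 ≤ c₁) (hP : 1 ≤ P) {r : ℕ}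
    [NeZero r] {χ : DirichletCharacter ℂ r} {β : ℝ} (h : IsExceptionalZero c₁ P r χ β) :
    0 ≤ (1 - β) * Real.log P ∧ (1 - β) * Real.log P ≤ c₁ := by
  obtain ⟨_, _, _, hβ, hβ1, _⟩ := h
  have hlog : 0 ≤ Real.log P := Real.log_nonneg hP
  refine ⟨mul_nonneg (by linarith) hlog, ?_⟩
  rcases hlog.eq_or_lt with h0 | hpos
  · rw [← h0, mul_zero]; exact hc₁
  · have h1 : 1 - β ≤ c₁ / Real.log P := by linarith
    calc (1 - β) * Real.log P ≤ c₁ / Real.log P * Real.log P :=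
          mul_le_mul_of_nonneg_right h1 hpos.le
      _ = c₁ := div_mul_cancel₀ c₁ hpos.ne'

/-! ### The correction of the single de-exceptionalised term -/

open scoped Classical in
/-- `∑#` without the exceptional correction differs from `∑#` with it only in the term of `χ̃`:
`‖gallagherTerm χ x h‖ ≤ ‖gallagherTermExc χ̃ β̃ χ x h‖ + 𝟙_{χ = χ̃} ∑_{x−h<n≤x} n^{β̃−1}`.
[cite: MontgomeryVaughanActa1975, §4 Lemma 4.3 (4.2)] -/
theorem norm_gallagherTerm_le_exc {r : ℕ} (χe : DirichletCharacter ℂ r) (β : ℝ) {q : ℕ}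
    (χ : DirichletCharacter ℂ q) (x h : ℕ) :
    ‖gallagherTerm χ x h‖ ≤ ‖gallagherTermExc χe β χ x h‖ +
      if q = r ∧ ∀ n : ℕ, χ (n : ZMod q) = χe (n : ZMod r) then
        ∑ n ∈ Ioc (x - h) x, (n : ℝ) ^ (β - 1) else 0 := by
  classical
  have hS : 0 ≤ ∑ n ∈ Ioc (x - h) x, (n : ℝ) ^ (β - 1) :=
    Finset.sum_nonneg fun n _ => Real.rpow_nonneg (Nat.cast_nonneg n) _
  have hid : gallagherTerm χ x h = gallagherTermExc χe β χ x h -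
      (if q = r ∧ ∀ n : ℕ, χ (n : ZMod q) = χe (n : ZMod r) then
        ((∑ n ∈ Ioc (x - h) x, (n : ℝ) ^ (β - 1) : ℝ) : ℂ) else 0) := by
    rw [gallagherTermExc]; ring
  rw [hid]
  refine (norm_sub_le _ _).trans (add_le_add le_rfl ?_)
  split_ifs
  · rw [Complex.norm_real, Real.norm_of_nonneg hS]
  · rw [norm_zero]

open scoped Classical in
/-- For a fixed modulus `r ≥ 1`, at most one character mod `r` agrees with `χ̃` on `ℕ` (a
character mod `r` is determined by its values on `ℕ`), so `∑*_χ 𝟙_{χ = χ̃} B ≤ B` for `B ≥ 0`.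
[folklore] -/
theorem sum_ite_identify_le {r : ℕ} [NeZero r] (χe : DirichletCharacter ℂ r) {B : ℝ}
    (hB : 0 ≤ B) :
    ∑ χ : DirichletCharacter ℂ r with χ.IsPrimitive,
        (if r = r ∧ ∀ n : ℕ, χ (n : ZMod r) = χe (n : ZMod r) then B else 0) ≤ B := by
  classical
  set F := (Finset.univ : Finset (DirichletCharacter ℂ r)).filter
    (fun χ => r = r ∧ ∀ n : ℕ, χ (n : ZMod r) = χe (n : ZMod r)) with hF
  have hcard : F.card ≤ 1 := by
    refine Finset.card_le_one.mpr fun χ₁ h₁ χ₂ h₂ => ?_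
    rw [hF, Finset.mem_filter] at h₁ h₂
    refine MulChar.ext' fun a => ?_
    have ha : ((a.val : ℕ) : ZMod r) = a := ZMod.natCast_zmod_val a
    rw [← ha, h₁.2.2 a.val, h₂.2.2 a.val]
  calc ∑ χ : DirichletCharacter ℂ r with χ.IsPrimitive,
        (if r = r ∧ ∀ n : ℕ, χ (n : ZMod r) = χe (n : ZMod r) then B else 0)
      ≤ ∑ χ : DirichletCharacter ℂ r,
          (if r = r ∧ ∀ n : ℕ, χ (n : ZMod r) = χe (n : ZMod r) then B else 0) :=
        Finset.sum_le_sum_of_subset_of_nonneg (Finset.filter_subset _ _)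
          fun χ _ _ => by split_ifs <;> simp [hB]
    _ = ∑ χ ∈ F, B := by rw [hF, Finset.sum_filter]
    _ = (F.card : ℝ) * B := by rw [Finset.sum_const, nsmul_eq_mul]
    _ ≤ 1 * B := by
        apply mul_le_mul_of_nonneg_right _ hB
        exact_mod_cast hcard
    _ = B := one_mul B

open scoped Classical in
/-- At most one term of `∑_{q} ∑*_χ` is identified with a given character `χ̃` mod `r̃ ≥ 1`, so
`∑_q ∑*_χ 𝟙_{χ = χ̃} B ≤ B` for `B ≥ 0`. [folklore] -/
theorem sum_sum_ite_identify_le {r : ℕ} [NeZero r] (χe : DirichletCharacter ℂ r) (I : Finset ℕ)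
    {B : ℝ} (hB : 0 ≤ B) :
    ∑ q ∈ I, ∑ χ : DirichletCharacter ℂ q with χ.IsPrimitive,
        (if q = r ∧ ∀ n : ℕ, χ (n : ZMod q) = χe (n : ZMod r) then B else 0) ≤ B := by
  classical
  set f : ℕ → ℝ := fun q => ∑ χ : DirichletCharacter ℂ q with χ.IsPrimitive,
    (if q = r ∧ ∀ n : ℕ, χ (n : ZMod q) = χe (n : ZMod r) then B else 0) with hf
  have hzero : ∀ q, q ≠ r → f q = 0 := by
    intro q hqr
    refine Finset.sum_eq_zero fun χ _ => ?_
    rw [if_neg (fun hc => hqr hc.1)]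
  have hsum : ∑ q ∈ I, f q = ∑ q ∈ I, (if q = r then f q else 0) := by
    refine Finset.sum_congr rfl fun q _ => ?_
    by_cases hqr : q = r
    · rw [if_pos hqr]
    · rw [if_neg hqr, hzero q hqr]
  have hfr : f r ≤ B := sum_ite_identify_le χe hB
  have hf0 : 0 ≤ f r :=
    Finset.sum_nonneg fun χ _ => by split_ifs <;> simp [hB]
  calc ∑ q ∈ I, f q = ∑ q ∈ I, (if q = r then f q else 0) := hsum
    _ = if r ∈ I then f r else 0 := Finset.sum_ite_eq' I r f
    _ ≤ B := by split_ifs <;> linarith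

/-- **The correction is small when `β̃` is not too close to `1`.** In the range
`exp(log^{1/2} N) ≤ P ≤ N^{1/4}` of Lemma 4.3, for `β < 1 − c/log P` (`c > 0`) and any naturals
`x, h`: `(h + N/P)⁻¹ ∑_{x−h<n≤x} n^{β−1} ≤ P⁻¹ + e^{2c} exp(−c log N/log P)` (split the `n` at `N/P²`:
the `n ≤ N/P²` are at most `N/P²` terms `≤ 1`, the others are at most `h` terms
`≤ (N/P²)^{β−1} ≤ (N/P²)^{−c/log P}`). [folklore] -/
theorem inv_mul_sum_rpow_le {N : ℕ} {P : ℝ} (hP : Real.exp (Real.sqrt (Real.log N)) ≤ P)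
    (hPN : P ≤ (N : ℝ) ^ (1 / 4 : ℝ)) {β c : ℝ} (hc : 0 < c) (hβ : β < 1 - c / Real.log P)
    (x h : ℕ) :
    ((h : ℝ) + N / P)⁻¹ * ∑ n ∈ Ioc (x - h) x, (n : ℝ) ^ (β - 1) ≤
      1 / P + Real.exp (2 * c) * Real.exp (-c * Real.log N / Real.log P) := by
  have hP1 : 1 ≤ P := le_trans (Real.one_le_exp (Real.sqrt_nonneg _)) hP
  have hP0 : 0 < P := by linarith
  have hN1 : 1 ≤ N := by
    by_contra hN
    have hN0 : N = 0 := by omega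
    subst hN0
    have : P ≤ 0 := by simpa [Real.zero_rpow (by norm_num : (1 / 4 : ℝ) ≠ 0)] using hPN
    linarith
  have hN1' : (1 : ℝ) ≤ N := by exact_mod_cast hN1
  have hN0 : (0 : ℝ) < N := by linarith
  have hlogP : 0 ≤ Real.log P := Real.log_nonneg hP1
  -- `β ≤ 1` (whether or not `log P = 0`)
  have hβ1 : β ≤ 1 := by
    have : 0 ≤ c / Real.log P := div_nonneg hc.le hlogP
    linarith
  -- `M = N/P² ≥ 1`
  set M : ℝ := N / P ^ 2 with hM
  have hP2N : P ^ 2 ≤ N := by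
    calc P ^ 2 ≤ ((N : ℝ) ^ (1 / 4 : ℝ)) ^ 2 := pow_le_pow_left₀ hP0.le hPN 2
      _ = (N : ℝ) ^ (1 / 2 : ℝ) := by
          rw [← Real.rpow_natCast, ← Real.rpow_mul hN0.le]; norm_num
      _ ≤ (N : ℝ) ^ (1 : ℝ) := Real.rpow_le_rpow_of_exponent_le hN1' (by norm_num)
      _ = N := Real.rpow_one _
  have hM1 : 1 ≤ M := by rw [hM, le_div_iff₀ (by positivity), one_mul]; exact hP2N
  have hM0 : 0 < M := by linarith
  -- split the sum at `M`
  set S := Ioc (x - h) x with hS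
  set A := S.filter fun n : ℕ => (n : ℝ) ≤ M with hA
  set B := S.filter fun n : ℕ => ¬ (n : ℝ) ≤ M with hB
  have hsplit : ∑ n ∈ S, (n : ℝ) ^ (β - 1) =
      ∑ n ∈ A, (n : ℝ) ^ (β - 1) + ∑ n ∈ B, (n : ℝ) ^ (β - 1) :=
    (Finset.sum_filter_add_sum_filter_not S (fun n : ℕ => (n : ℝ) ≤ M) _).symm
  -- the small `n`: at most `M` terms, each `≤ 1`
  have hAsum : ∑ n ∈ A, (n : ℝ) ^ (β - 1) ≤ M := by
    have hterm : ∀ n ∈ A, (n : ℝ) ^ (β - 1) ≤ 1 := by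
      intro n hn
      rw [hA, Finset.mem_filter, hS, Finset.mem_Ioc] at hn
      have hn1 : (1 : ℝ) ≤ n := by exact_mod_cast (show 1 ≤ n by omega)
      exact Real.rpow_le_one_of_one_le_of_nonpos hn1 (by linarith)
    have hcard : (A.card : ℝ) ≤ M := by
      have hsub : A ⊆ Finset.Icc 1 ⌊M⌋₊ := by
        intro n hn
        rw [hA, Finset.mem_filter, hS, Finset.mem_Ioc] at hn
        rw [Finset.mem_Icc]
        exact ⟨by omega, Nat.le_floor hn.2⟩
      calc (A.card : ℝ) ≤ ((Finset.Icc 1 ⌊M⌋₊).card : ℝ) := by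
            exact_mod_cast Finset.card_le_card hsub
        _ = ⌊M⌋₊ := by rw [Nat.card_Icc]; push_cast; ring
        _ ≤ M := Nat.floor_le hM0.le
    calc ∑ n ∈ A, (n : ℝ) ^ (β - 1) ≤ ∑ n ∈ A, (1 : ℝ) := Finset.sum_le_sum hterm
      _ = A.card := by rw [Finset.sum_const, nsmul_eq_mul, mul_one]
      _ ≤ M := hcard
  -- the large `n`: at most `h` terms, each `≤ M^{β−1}`
  have hBsum : ∑ n ∈ B, (n : ℝ) ^ (β - 1) ≤ h * M ^ (β - 1) := by
    have hterm : ∀ n ∈ B, (n : ℝ) ^ (β - 1) ≤ M ^ (β - 1) := by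
      intro n hn
      rw [hB, Finset.mem_filter, not_le] at hn
      exact Real.rpow_le_rpow_of_nonpos hM0 hn.2.le (by linarith)
    have hcard : (B.card : ℝ) ≤ h := by
      have h1 : B.card ≤ S.card := Finset.card_le_card (Finset.filter_subset _ _)
      have h2 : S.card = x - (x - h) := by rw [hS, Nat.card_Ioc]
      have h3 : x - (x - h) ≤ h := by omega
      exact_mod_cast h1.trans (h2 ▸ h3)
    calc ∑ n ∈ B, (n : ℝ) ^ (β - 1) ≤ ∑ n ∈ B, M ^ (β - 1) := Finset.sum_le_sum hterm
      _ = B.card * M ^ (β - 1) := by rw [Finset.sum_const, nsmul_eq_mul]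
      _ ≤ h * M ^ (β - 1) :=
          mul_le_mul_of_nonneg_right hcard (Real.rpow_nonneg hM0.le _)
  -- the weight
  set w : ℝ := ((h : ℝ) + N / P)⁻¹ with hw
  have hNP : 0 < (N : ℝ) / P := div_pos hN0 hP0
  have hden : 0 < (h : ℝ) + N / P := by positivity
  have hw0 : 0 < w := inv_pos.mpr hden
  have hw1 : w * M ≤ 1 / P := by
    have hle : w ≤ ((N : ℝ) / P)⁻¹ := by
      rw [hw]; exact inv_anti₀ hNP (by linarith [(Nat.cast_nonneg h : (0 : ℝ) ≤ h)])
    calc w * M ≤ ((N : ℝ) / P)⁻¹ * M := mul_le_mul_of_nonneg_right hle hM0.le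
      _ = 1 / P := by rw [hM]; field_simp
  have hw2 : w * (h * M ^ (β - 1)) ≤ M ^ (β - 1) := by
    have hwh : w * h ≤ 1 := by
      rw [hw, inv_mul_le_iff₀ hden, mul_one]; linarith
    calc w * (h * M ^ (β - 1)) = (w * h) * M ^ (β - 1) := by ring
      _ ≤ 1 * M ^ (β - 1) := mul_le_mul_of_nonneg_right hwh (Real.rpow_nonneg hM0.le _)
      _ = M ^ (β - 1) := one_mul _
  -- `M^{β−1} ≤ e^{2c} exp(−c log N / log P)`
  have hM3 : M ^ (β - 1) ≤ Real.exp (2 * c) * Real.exp (-c * Real.log N / Real.log P) := by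
    rcases hlogP.eq_or_lt with h0 | hpos
    · -- `log P = 0`: the right-hand side is `e^{2c} ≥ 1 ≥ M^{β−1}`
      rw [← h0, div_zero, Real.exp_zero, mul_one]
      calc M ^ (β - 1) ≤ 1 := Real.rpow_le_one_of_one_le_of_nonpos hM1 (by linarith)
        _ ≤ Real.exp (2 * c) := Real.one_le_exp (by linarith)
    · have hexp : β - 1 ≤ -c / Real.log P := by rw [neg_div]; linarith
      have hlogM : Real.log M = Real.log N - 2 * Real.log P := by
        rw [hM, Real.log_div hN0.ne' (by positivity), Real.log_pow]; push_cast; ring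
      calc M ^ (β - 1) ≤ M ^ (-c / Real.log P) := Real.rpow_le_rpow_of_exponent_le hM1 hexp
        _ = Real.exp (Real.log M * (-c / Real.log P)) := Real.rpow_def_of_pos hM0 _
        _ = Real.exp (2 * c) * Real.exp (-c * Real.log N / Real.log P) := by
            rw [← Real.exp_add, hlogM]
            congr 1
            field_simp
            ring
  -- assemble
  calc w * ∑ n ∈ S, (n : ℝ) ^ (β - 1)
      = w * ∑ n ∈ A, (n : ℝ) ^ (β - 1) + w * ∑ n ∈ B, (n : ℝ) ^ (β - 1) := by
        rw [hsplit, mul_add]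
    _ ≤ w * M + w * (h * M ^ (β - 1)) :=
        add_le_add (mul_le_mul_of_nonneg_left hAsum hw0.le) (mul_le_mul_of_nonneg_left hBsum hw0.le)
    _ ≤ 1 / P + M ^ (β - 1) := add_le_add hw1 hw2
    _ ≤ 1 / P + Real.exp (2 * c) * Real.exp (-c * Real.log N / Real.log P) :=
        add_le_add le_rfl hM3

/-- In the range `P ≥ exp(log^{1/2} N)` of Lemma 4.3: `P⁻¹ ≤ exp(−c log N/log P)` for `c ≤ 1`
(`log² P ≥ log N`). [folklore] -/
theorem one_div_le_exp_neg {N : ℕ} {P : ℝ} (hP : Real.exp (Real.sqrt (Real.log N)) ≤ P) {c : ℝ}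
    (hc1 : c ≤ 1) : 1 / P ≤ Real.exp (-c * Real.log N / Real.log P) := by
  have hP1 : 1 ≤ P := le_trans (Real.one_le_exp (Real.sqrt_nonneg _)) hP
  have hP0 : 0 < P := by linarith
  have hlogP : 0 ≤ Real.log P := Real.log_nonneg hP1
  have hlogN : 0 ≤ Real.log (N : ℝ) := Real.log_natCast_nonneg N
  have hsqrt : Real.sqrt (Real.log N) ≤ Real.log P := by
    have := Real.log_le_log (Real.exp_pos _) hP
    rwa [Real.log_exp] at this
  have hinv : 1 / P = Real.exp (-Real.log P) := by
    rw [Real.exp_neg, Real.exp_log hP0, one_div]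
  rw [hinv, Real.exp_le_exp]
  -- `−log P ≤ −c log N / log P`
  rcases hlogP.eq_or_lt with h0 | hpos
  · rw [← h0, div_zero, neg_zero]
  · rw [neg_mul, neg_div, neg_le_neg_iff, div_le_iff₀ hpos]
    have hsq : Real.log N ≤ Real.log P * Real.log P := by
      calc Real.log (N : ℝ) = Real.sqrt (Real.log N) * Real.sqrt (Real.log N) :=
            (Real.mul_self_sqrt hlogN).symm
        _ ≤ Real.log P * Real.log P :=
            mul_le_mul hsqrt hsqrt (Real.sqrt_nonneg _) hlogP
    calc c * Real.log N ≤ 1 * Real.log N := mul_le_mul_of_nonneg_right hc1 hlogN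
      _ ≤ Real.log P * Real.log P := by rw [one_mul]; exact hsq

/-- Monotonicity of the saving in the exponent: `exp(−a log N/log P) ≤ exp(−b log N/log P)` for
`b ≤ a` (`log N, log P ≥ 0`, `P ≥ 1`). [folklore] -/
theorem exp_neg_mul_log_div_log_le {N : ℕ} {P : ℝ} (hP : 1 ≤ P) {a b : ℝ} (hba : b ≤ a) :
    Real.exp (-a * Real.log N / Real.log P) ≤ Real.exp (-b * Real.log N / Real.log P) := by
  rw [Real.exp_le_exp]
  have hL : 0 ≤ Real.log (N : ℝ) / Real.log P :=
    div_nonneg (Real.log_natCast_nonneg N) (Real.log_nonneg hP)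
  have h1 : -a * Real.log N / Real.log P = -a * (Real.log N / Real.log P) := by ring
  have h2 : -b * Real.log N / Real.log P = -b * (Real.log N / Real.log P) := by ring
  rw [h1, h2]
  nlinarith

/-! ### Lemma 4.3 is antitone in `c₁` -/

open scoped Classical in
/-- **LEMMA 4.3 is antitone in the constant `c₁` of Lemma 4.1** (Montgomery–Vaughan 1975, (4.2),
p. 357–358): if (4.2) holds with the exceptional character delineated at level `c₁`
(`1 − c₁/log P ≤ β̃`), then it holds at every level `0 < c₁' ≤ c₁`, with
`c₃' = min(c₃, c₁', 1)`, `c₄' = min(c₄, 1/4)` and a constant depending on `C, c₁, c₁'`. Cases: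
no `c₁`-exceptional zero — the same bound; a `c₁`-exceptional `β̃` of `χ̃` that is not
`c₁'`-exceptional — bound `∑#` without correction by `∑#` with the correction of the term of `χ̃`
(`norm_gallagherTerm_le_exc`, at most one term: `sum_sum_ite_identify_le`), whose size is
`≤ P⁻¹ + e^{2c₁'} exp(−c₁' log N/log P)` (`inv_mul_sum_rpow_le`, as `β̃ < 1 − c₁'/log P`), and
use the reduced bound `C (1 − β̃)(log P) ≤ C c₁`; a `c₁'`-exceptional datum — it is
`c₁`-exceptional (`IsExceptionalZero.mono`). [cite: MontgomeryVaughanActa1975, §4 Lemma 4.3 (4.2)] -/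
theorem lemma43At_anti {c₁ c₁' : ℝ} (hc₁' : 0 < c₁') (hle : c₁' ≤ c₁) (h : lemma43At c₁) :
    lemma43At c₁' := by
  obtain ⟨c₃, hc₃, c₄, hc₄, C, H⟩ := h
  have hc₁ : 0 < c₁ := lt_of_lt_of_le hc₁' hle
  set c₃' : ℝ := min c₃ (min c₁' 1) with hc₃'
  have hc₃'0 : 0 < c₃' := lt_min hc₃ (lt_min hc₁' one_pos)
  have hc₃'le₃ : c₃' ≤ c₃ := min_le_left _ _
  have hc₃'le₁ : c₃' ≤ c₁' := (min_le_right _ _).trans (min_le_left _ _)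
  have hc₃'le1 : c₃' ≤ 1 := (min_le_right _ _).trans (min_le_right _ _)
  set C' : ℝ := max C 0 * (1 + c₁) + 1 + Real.exp (2 * c₁') with hC'
  have hC0 : 0 ≤ max C 0 := le_max_right _ _
  refine ⟨c₃', hc₃'0, min c₄ (1 / 4), lt_min hc₄ (by norm_num), C', fun N P hP hPN x h hx hh => ?_⟩
  have hP1 : 1 ≤ P := le_trans (Real.one_le_exp (Real.sqrt_nonneg _)) hP
  have hP0 : 0 < P := by linarith
  -- the range hypothesis of `lemma43At c₁`
  have hmin : 0 < min c₄ (1 / 4 : ℝ) := lt_min hc₄ (by norm_num)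
  have hN1 : (1 : ℝ) ≤ N := by
    by_contra hN
    have hN0 : N = 0 := by
      have h' : N < 1 := by exact_mod_cast not_le.mp hN
      omega
    subst hN0
    have h0 : ((0 : ℕ) : ℝ) ^ min c₄ (1 / 4 : ℝ) = 0 := by
      rw [Nat.cast_zero, Real.zero_rpow hmin.ne']
    have : P ≤ 0 := hPN.trans h0.le
    linarith
  have hPN₄ : P ≤ (N : ℝ) ^ c₄ :=
    hPN.trans (Real.rpow_le_rpow_of_exponent_le hN1 (min_le_left _ _))
  have hPN' : P ≤ (N : ℝ) ^ (1 / 4 : ℝ) :=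
    hPN.trans (Real.rpow_le_rpow_of_exponent_le hN1 (min_le_right _ _))
  obtain ⟨Hno, Hexc⟩ := H N P hP hPN₄ x h hx hh
  -- abbreviations
  set E : ℝ := Real.exp (-c₃ * Real.log N / Real.log P) with hE
  set E' : ℝ := Real.exp (-c₃' * Real.log N / Real.log P) with hE'
  have hEE' : E ≤ E' := exp_neg_mul_log_div_log_le hP1 hc₃'le₃
  have hE0 : 0 ≤ E := (Real.exp_pos _).le
  have hE'0 : 0 ≤ E' := (Real.exp_pos _).le
  have hCle : C ≤ max C 0 := le_max_left _ _
  -- every weighted sum is nonnegative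
  have hwpos : ∀ (q : ℕ) (χ : DirichletCharacter ℂ q), 0 ≤ ((h q χ : ℝ) + N / P)⁻¹ := by
    intro q χ; positivity
  refine ⟨fun hno => ?_, fun r _ χe β hEZ => ?_⟩
  · -- no `c₁'`-exceptional zero
    by_cases hex : ∃ (r : ℕ) (_ : NeZero r) (χe : DirichletCharacter ℂ r) (β : ℝ),
        IsExceptionalZero c₁ P r χe β
    · -- a `c₁`-exceptional zero `β̃` of `χ̃`, not `c₁'`-exceptional
      obtain ⟨r, hr, χe, β, hEZ⟩ := hex
      have hβlt : β < 1 - c₁' / Real.log P := hEZ.lt_of_not (hno r χe β)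
      obtain ⟨hL0, hLc⟩ := hEZ.one_sub_mul_log_le hc₁.le hP1
      have hb := Hexc r χe β hEZ
      -- the corrected sum is `≤ C c₁ E`
      have hb' : ∑ q ∈ Icc 1 ⌊P⌋₊, ∑ χ : DirichletCharacter ℂ q with χ.IsPrimitive,
          ((h q χ : ℝ) + N / P)⁻¹ * ‖gallagherTermExc χe β χ (x q χ) (h q χ)‖ ≤
            max C 0 * c₁ * E := by
        calc _ ≤ C * ((1 - β) * Real.log P) * E := hb
          _ ≤ max C 0 * ((1 - β) * Real.log P) * E :=
              mul_le_mul_of_nonneg_right (mul_le_mul_of_nonneg_right hCle hL0) hE0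
          _ ≤ max C 0 * c₁ * E :=
              mul_le_mul_of_nonneg_right (mul_le_mul_of_nonneg_left hLc hC0) hE0
      -- the correction, term by term
      set B : ℝ := 1 / P + Real.exp (2 * c₁') * Real.exp (-c₁' * Real.log N / Real.log P) with hB
      have hB0 : 0 ≤ B := by positivity
      have hterm : ∀ (q : ℕ) (χ : DirichletCharacter ℂ q),
          ((h q χ : ℝ) + N / P)⁻¹ * ‖gallagherTerm χ (x q χ) (h q χ)‖ ≤
            ((h q χ : ℝ) + N / P)⁻¹ * ‖gallagherTermExc χe β χ (x q χ) (h q χ)‖ +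
              (if q = r ∧ ∀ n : ℕ, χ (n : ZMod q) = χe (n : ZMod r) then B else 0) := by
        intro q χ
        have h1 := norm_gallagherTerm_le_exc χe β χ (x q χ) (h q χ)
        have h2 := inv_mul_sum_rpow_le hP hPN' hc₁' hβlt (x q χ) (h q χ)
        calc ((h q χ : ℝ) + N / P)⁻¹ * ‖gallagherTerm χ (x q χ) (h q χ)‖
            ≤ ((h q χ : ℝ) + N / P)⁻¹ * (‖gallagherTermExc χe β χ (x q χ) (h q χ)‖ +
                if q = r ∧ ∀ n : ℕ, χ (n : ZMod q) = χe (n : ZMod r) then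
                  ∑ n ∈ Ioc (x q χ - h q χ) (x q χ), (n : ℝ) ^ (β - 1) else 0) :=
              mul_le_mul_of_nonneg_left h1 (hwpos q χ)
          _ = ((h q χ : ℝ) + N / P)⁻¹ * ‖gallagherTermExc χe β χ (x q χ) (h q χ)‖ +
                (if q = r ∧ ∀ n : ℕ, χ (n : ZMod q) = χe (n : ZMod r) then
                  ((h q χ : ℝ) + N / P)⁻¹ *
                    ∑ n ∈ Ioc (x q χ - h q χ) (x q χ), (n : ℝ) ^ (β - 1) else 0) := by
              split_ifs <;> ring
          _ ≤ _ := by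
              refine add_le_add le_rfl ?_
              split_ifs
              · exact h2
              · exact le_rfl
      have hcorr := sum_sum_ite_identify_le χe (Icc 1 ⌊P⌋₊) hB0
      have hBle : B ≤ (1 + Real.exp (2 * c₁')) * E' := by
        have h1 : 1 / P ≤ E' := one_div_le_exp_neg hP hc₃'le1
        have h2 : Real.exp (-c₁' * Real.log N / Real.log P) ≤ E' :=
          exp_neg_mul_log_div_log_le hP1 hc₃'le₁
        calc B ≤ E' + Real.exp (2 * c₁') * E' :=
              add_le_add h1 (mul_le_mul_of_nonneg_left h2 (Real.exp_pos _).le)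
          _ = (1 + Real.exp (2 * c₁')) * E' := by ring
      calc ∑ q ∈ Icc 1 ⌊P⌋₊, ∑ χ : DirichletCharacter ℂ q with χ.IsPrimitive,
            ((h q χ : ℝ) + N / P)⁻¹ * ‖gallagherTerm χ (x q χ) (h q χ)‖
          ≤ ∑ q ∈ Icc 1 ⌊P⌋₊, ∑ χ : DirichletCharacter ℂ q with χ.IsPrimitive,
              (((h q χ : ℝ) + N / P)⁻¹ * ‖gallagherTermExc χe β χ (x q χ) (h q χ)‖ +
                (if q = r ∧ ∀ n : ℕ, χ (n : ZMod q) = χe (n : ZMod r) then B else 0)) :=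
            Finset.sum_le_sum fun q _ => Finset.sum_le_sum fun χ _ => hterm q χ
        _ = (∑ q ∈ Icc 1 ⌊P⌋₊, ∑ χ : DirichletCharacter ℂ q with χ.IsPrimitive,
              ((h q χ : ℝ) + N / P)⁻¹ * ‖gallagherTermExc χe β χ (x q χ) (h q χ)‖) +
            ∑ q ∈ Icc 1 ⌊P⌋₊, ∑ χ : DirichletCharacter ℂ q with χ.IsPrimitive,
              (if q = r ∧ ∀ n : ℕ, χ (n : ZMod q) = χe (n : ZMod r) then B else 0) := by
            rw [← Finset.sum_add_distrib]
            refine Finset.sum_congr rfl fun q _ => ?_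
            rw [← Finset.sum_add_distrib]
        _ ≤ max C 0 * c₁ * E + B := add_le_add hb' hcorr
        _ ≤ max C 0 * c₁ * E' + (1 + Real.exp (2 * c₁')) * E' :=
            add_le_add (mul_le_mul_of_nonneg_left hEE' (mul_nonneg hC0 hc₁.le)) hBle
        _ ≤ C' * E' := by
            rw [hC']
            have : 0 ≤ max C 0 * E' := mul_nonneg hC0 hE'0
            nlinarith
    · -- no `c₁`-exceptional zero either
      push Not at hex
      have hb := Hno fun r hr χ β => hex r hr χ β
      calc _ ≤ C * E := hb
        _ ≤ max C 0 * E := mul_le_mul_of_nonneg_right hCle hE0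
        _ ≤ max C 0 * E' := mul_le_mul_of_nonneg_left hEE' hC0
        _ ≤ C' * E' := by
            apply mul_le_mul_of_nonneg_right _ hE'0
            rw [hC']
            have : 0 ≤ Real.exp (2 * c₁') := (Real.exp_pos _).le
            nlinarith
  · -- a `c₁'`-exceptional datum is `c₁`-exceptional
    have hEZ₁ : IsExceptionalZero c₁ P r χe β := hEZ.mono hle hP1
    obtain ⟨hL0, _⟩ := hEZ₁.one_sub_mul_log_le hc₁.le hP1
    have hb := Hexc r χe β hEZ₁
    calc _ ≤ C * ((1 - β) * Real.log P) * E := hb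
      _ ≤ max C 0 * ((1 - β) * Real.log P) * E :=
          mul_le_mul_of_nonneg_right (mul_le_mul_of_nonneg_right hCle hL0) hE0
      _ ≤ max C 0 * ((1 - β) * Real.log P) * E' :=
          mul_le_mul_of_nonneg_left hEE' (mul_nonneg hC0 hL0)
      _ ≤ C' * ((1 - β) * Real.log P) * E' := by
          apply mul_le_mul_of_nonneg_right _ hE'0
          apply mul_le_mul_of_nonneg_right _ hL0
          rw [hC']
          have : 0 ≤ Real.exp (2 * c₁') := (Real.exp_pos _).le
          nlinarith

/-- **Lemma 4.3 at every small level from the unparametrised fact**: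
`lemma43_gallagher → ∀ c₁' ∈ (0, c₁], lemma43At c₁'` for the `c₁` it provides; in particular
`lemma43At c₁'` for all sufficiently small `c₁' > 0`. [cite: MontgomeryVaughanActa1975, §4 Lemma 4.3 (4.2)] -/
theorem lemma43At_small_of_lemma43_gallagher (h : lemma43_gallagher) :
    ∃ c : ℝ, 0 < c ∧ ∀ c₁ : ℝ, 0 < c₁ → c₁ ≤ c → lemma43At c₁ := by
  obtain ⟨c₁, hc₁, h43⟩ := lemma43_gallagher_iff.mp h
  exact ⟨c₁, hc₁, fun c₁' h0 hle => lemma43At_anti h0 hle h43⟩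

/-! ### The §6 formulae are antitone in `c₁` -/

/-- **`section6_formulae` is antitone in `c₁`**: (6.1͂7) at level `c₁` covers every datum
exceptional at a level `c₁' ≤ c₁` (after enlarging `X₀` so that `P = X^{6δ} ≥ 1`); (6.17) does not
involve `c₁`. [cite: MontgomeryVaughanActa1975, §6 (6.17) and (6.17~)] -/
theorem section6_formulae_anti {c₁ c₁' : ℝ} (hle : c₁' ≤ c₁) (h : section6_formulae c₁) :
    section6_formulae c₁' := by
  obtain ⟨C, hC, δ₀, hδ₀, H⟩ := h
  refine ⟨C, hC, δ₀, hδ₀, fun δ hδ hδle => ?_⟩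
  obtain ⟨X₀, hX₀⟩ := H δ hδ hδle
  refine ⟨max X₀ 1, fun X hX => ?_⟩
  have hXX₀ : X₀ ≤ X := (le_max_left _ _).trans hX
  have hX1 : 1 ≤ X := (le_max_right _ _).trans hX
  have hP1 : 1 ≤ X ^ (6 * δ) := Real.one_le_rpow hX1 (by linarith)
  obtain ⟨h17, h17e⟩ := hX₀ X hXX₀
  exact ⟨h17, fun r _ χ β hEZ hquad => h17e r χ β (hEZ.mono hle hP1) hquad⟩

/-! ### §7, (8.3) and Theorem 1 from `lemma43_gallagher` -/

/-- **§7 from the unparametrised Lemma 4.3**: `lemma43_gallagher → section7_errorBounds c₁` for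
every `c₁` below an absolute constant (the minimum of Page's constant, `lemma41At_of_lt`, and the
level provided by the fact). [cite: MontgomeryVaughanActa1975, §7 (7.1) and (7.1~)] -/
theorem section7_errorBounds_of_lemma43_gallagher (h : lemma43_gallagher) :
    ∃ c : ℝ, 0 < c ∧ ∀ c₁ : ℝ, 0 < c₁ → c₁ < c → section7_errorBounds c₁ := by
  obtain ⟨c, hc, h43⟩ := lemma43At_small_of_lemma43_gallagher h
  obtain ⟨c', hc', h7⟩ := section7_errorBounds_of_lemma43At_small
  exact ⟨min c c', lt_min hc hc', fun c₁ h0 hlt =>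
    h7 c₁ h0 (hlt.trans_le (min_le_right _ _)) (h43 c₁ h0 (hlt.le.trans (min_le_left _ _)))⟩

/-- **The major-arc formulae from Lemma 4.3 and §6**: `lemma43_gallagher → (∃ c₁ > 0,
section6_formulae c₁) → majorArc_formulae` (both inputs are antitone in `c₁`, so they meet at a
common small level, where §7 is `section7_errorBounds_of_lemma43_gallagher` and the insertion is
`majorArc_formulae_of_sections`). [cite: MontgomeryVaughanActa1975, §6 (6.17), (6.17~) and §7 (7.1), (7.1~)] -/
theorem majorArc_formulae_of_lemma43_gallagher (h43 : lemma43_gallagher)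
    (h6 : ∃ c₁ : ℝ, 0 < c₁ ∧ section6_formulae c₁) : majorArc_formulae := by
  obtain ⟨c, hc, h7⟩ := section7_errorBounds_of_lemma43_gallagher h43
  obtain ⟨c₆, hc₆, h6⟩ := h6
  set c₁ : ℝ := min (c / 2) c₆ with hc₁
  have hc₁0 : 0 < c₁ := lt_min (half_pos hc) hc₆
  have hc₁c : c₁ < c := lt_of_le_of_lt (min_le_left _ _) (half_lt_self hc)
  exact majorArc_formulae_of_sections hc₁0 (section6_formulae_anti (min_le_right _ _) h6)
    (h7 c₁ hc₁0 hc₁c)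

/-- **(8.3) of Montgomery–Vaughan 1975 from Lemma 4.3 and §6** — the discharge route of the named
fact `majorArc_lowerBound`: `lemma43_gallagher → (∃ c₁ > 0, section6_formulae c₁) → majorArc_lowerBound`
(§8 is `majorArc_lowerBound_of_formulae`, PROVED). [cite: MontgomeryVaughanActa1975, §8 (8.3)] -/
theorem majorArc_lowerBound_of_lemma43_gallagher (h43 : lemma43_gallagher)
    (h6 : ∃ c₁ : ℝ, 0 < c₁ ∧ section6_formulae c₁) : majorArc_lowerBound :=
  majorArc_lowerBound_of_formulae (majorArc_formulae_of_lemma43_gallagher h43 h6)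

end Literature.NumberTheory.Sieve.MontgomeryVaughan1975

namespace Literature.NumberTheory.Sieve

open MontgomeryVaughan1975

/-- **Montgomery–Vaughan 1975, Theorem 1, from Lemma 4.3 and §6** (parity.S15): Gallagher's
Theorem 7 as modified (the named fact `lemma43_gallagher`) and the §6 formulae at any one level
`c₁ > 0` imply `E(X) ≪ X^{1−δ}`; Lemmas 4.1 (Page), 4.2 (Gallagher's Lemma 1), §7, §8, the minor
arcs (3.2), Vinogradov's Lemma 3.1 and (6.17) are PROVED in the tree.
[cite: MontgomeryVaughanActa1975, Theorem 1] -/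
theorem goldbachExceptionalCount_isBigO_rpow_of_lemma43_gallagher (h43 : lemma43_gallagher)
    (h6 : ∃ c₁ : ℝ, 0 < c₁ ∧ section6_formulae c₁) : goldbachExceptionalCount_isBigO_rpow :=
  goldbachExceptionalCount_isBigO_rpow_of_formulae (majorArc_formulae_of_lemma43_gallagher h43 h6)

end Literature.NumberTheory.Sieve
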